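import Mathlib
import Summits.Ventures.PercRepro2.Defs
import Summits.Ventures.PercRepro2.Independence
import Summits.Ventures.PercRepro2.Harris
import Summits.Ventures.PercRepro2.Graph
import Summits.Ventures.PercRepro2.Exploration
import Summits.Ventures.PercRepro2.Induced
import Summits.Ventures.PercRepro2.R2PrimeThreeReduction
import Summits.Ventures.PercRepro2.YBridge
import Summits.Ventures.PercRepro2.HCov
import Summits.Ventures.PercRepro2.HubModel
import Summits.Ventures.PercRepro2.HubLaw
import Summits.Ventures.PercRepro2.HubRootLaw
import Summits.Ventures.PercRepro2.HubConn
import Summits.Ventures.PercRepro2.HubBernstein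
import Summits.Ventures.PercRepro2.HubGc
import Summits.Ventures.PercRepro2.HubKron
import Summits.Ventures.PercRepro2.HubCert
import Summits.Ventures.PercRepro2.HubCertPart1
import Summits.Ventures.PercRepro2.HubCertPart2
import Summits.Ventures.PercRepro2.HubCertPart3
import Summits.Ventures.PercRepro2.HubCertPart4
import Summits.Ventures.PercRepro2.HubCertPart5
import Summits.Ventures.PercRepro2.HubCertPart6
import Summits.Ventures.PercRepro2.HubCertAll
import Summits.Ventures.PercRepro2.HubKernelChunk0
import Summits.Ventures.PercRepro2.HubKernelChunk1
import Summits.Ventures.PercRepro2.HubKernelChunk2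
import Summits.Ventures.PercRepro2.HubKernelChunk3
import Summits.Ventures.PercRepro2.HubHarris

/-!
# THE HUB THEOREM: (HCOV) holds on the class R
(blind cell PercRepro2, typer-1 g8; MINE2-HUB.md §1–§2, HUB-LEAN-SCOPE.md (S6))

**Theorem** (`HCov_of_classR`).  Let `G` be a finite weighted multigraph with five distinct marks
`o, a₁, a₂, a₃, b` (an injective `markOf`) such that every edge at a root `a₁`, `a₂` joins two
marks (`ClassR`), and let the edge weights be admissible (`IsProbVec p`).  Then the covariance
form is nonnegative: `CovForm.HCov p ends o a₁ a₂ a₃ b`, i.e. `0 ≤ Gc`.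

Proof: `Gc = GcB q m` (`HubGc.Gc_eq_GcB`, the structural lemma + the hub law + the root-edge law),
`GcB q m = Σ_k bern q k · C_k(m)` (`HubGc.GcB_eq_sum`, the Bernstein regrouping), the bundle
weights `q = bundleProb` lie in `[0, 1]` (`bundleProb_mem`), and every coefficient cubic
`C_k(m) ≥ 0` (`HubCert.Ck_nonneg_of_check`) by the kernel-checked coefficient identity
`coeff_identity` below (the 330 cubics are mine-2's certified ones, the 16054 others vanish;
the fifth kernel chunk `hub_check_4` and the assembly `hub_check` of `HubKernelChunk0.lean` …
`HubKernelChunk3.lean` live here too)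
together with the Harris slacks of the inner law (`HubHarris.Hslack_nonneg`), the vanishing of
the inconsistent patterns (`prob_innerPat_eq_zero`) and the nonnegativity of the masses.
Everything is kernel-checked; no `native_decide`.
-/

namespace Summit.Ventures.PercRepro2.Hub

set_option maxHeartbeats 0 in
set_option maxRecDepth 100000 in
/-- **The kernel check, first index `4`.** -/
theorem hub_check_4 : ∀ b d : Fin 5, 2 * kronSym 4 b d = certNum 4 b d := by
  decide +kernel

/-- **THE KERNEL CHECK**: the doubled symmetrised hub table equals the symmetrised certificates,
for every atom triple, as Kronecker numbers. -/
theorem hub_check : ∀ a b d : Fin 5, 2 * kronSym a b d = certNum a b d := by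
  intro a
  fin_cases a
  · exact hub_check_0
  · exact hub_check_1
  · exact hub_check_2
  · exact hub_check_3
  · exact hub_check_4

section Bridge

/-- The symmetrised hub number is the Kronecker number of the symmetrised hub table. -/
lemma kronSym_eq (a b d : Fin 5) : kronSym a b d = ∑ k, sym3 (W5 k) a b d * KB ^ idx4K k := by
  unfold kronSym
  simp only [kronW_eq, ← Finset.sum_add_distrib]
  refine Finset.sum_congr rfl fun k _ => ?_
  unfold sym3 W5
  ring

/-- A list of keyed certificates, summed with Kronecker weights, regroups by the type vector of the
key. -/
lemma list_sum_eq_sum_fiber (L : List (ℕ × Cert)) (hL : ∀ e ∈ L, e.1 < 16384) (G : Cert → ℤ) :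
    (L.map fun e => G e.2 * KB ^ e.1).sum =
      ∑ k, ((L.filter fun e => e.1 = idx4K k).map fun e => G e.2).sum * KB ^ idx4K k := by
  induction L with
  | nil => simp
  | cons e L ih =>
    have he := hL e (List.mem_cons_self ..)
    have ih' := ih fun e' he' => hL e' (List.mem_cons_of_mem _ he')
    simp only [List.map_cons, List.sum_cons, ih']
    have hsplit : ∀ k : Fin 7 → Fin 4,
        (((e :: L).filter fun e' => e'.1 = idx4K k).map fun e' => G e'.2).sum =
          (if e.1 = idx4K k then G e.2 else 0) +
            ((L.filter fun e' => e'.1 = idx4K k).map fun e' => G e'.2).sum := by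
      intro k
      by_cases h : e.1 = idx4K k
      · simp [h]
      · simp [h]
    simp only [hsplit, add_mul, Finset.sum_add_distrib]
    congr 1
    have hk : ∀ k : Fin 7 → Fin 4, e.1 = idx4K k ↔ k = decode4 e.1 := by
      intro k
      constructor
      · intro h
        rw [h, decode4_idx4K]
      · intro h
        rw [h, idx4K_decode4 he]
    simp only [hk, ite_mul, zero_mul]
    rw [Finset.sum_ite_eq' Finset.univ (decode4 e.1)]
    simp [idx4K_decode4 he]

/-- The absolute value of a filtered list sum is at most the sum of the absolute values. -/
lemma abs_filter_sum_le (L : List (ℕ × Cert)) (P : ℕ × Cert → Bool) (G : Cert → ℤ) :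
    |((L.filter P).map fun e => G e.2).sum| ≤ (L.map fun e => |G e.2|).sum := by
  induction L with
  | nil => simp
  | cons e L ih =>
    simp only [List.map_cons, List.sum_cons]
    by_cases h : P e = true
    · rw [List.filter_cons_of_pos h]
      simp only [List.map_cons, List.sum_cons]
      exact (abs_add_le _ _).trans (add_le_add le_rfl ih)
    · rw [List.filter_cons_of_neg h]
      exact ih.trans (le_add_of_nonneg_left (abs_nonneg _))

/-- The doubled symmetrised hub table is a balanced digit vector. -/
lemma abs_two_sym3_W5_lt (k : Fin 7 → Fin 4) (a b d : Fin 5) :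
    |2 * sym3 (W5 k) a b d| < 2 ^ 31 := by
  unfold sym3 W5
  have h1 := abs_le.1 (abs_Wtot_le k (atomPat a) (atomPat b) (atomPat d))
  have h2 := abs_le.1 (abs_Wtot_le k (atomPat a) (atomPat d) (atomPat b))
  have h3 := abs_le.1 (abs_Wtot_le k (atomPat b) (atomPat a) (atomPat d))
  have h4 := abs_le.1 (abs_Wtot_le k (atomPat b) (atomPat d) (atomPat a))
  have h5 := abs_le.1 (abs_Wtot_le k (atomPat d) (atomPat a) (atomPat b))
  have h6 := abs_le.1 (abs_Wtot_le k (atomPat d) (atomPat b) (atomPat a))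
  rw [abs_lt]
  constructor <;> linarith

/-- **THE COEFFICIENT IDENTITY**: for every type vector, the doubled symmetrised hub table equals
the symmetrised certificates of the list. -/
theorem coeff_identity (k : Fin 7 → Fin 4) (a b d : Fin 5) :
    2 * sym3 (W5 k) a b d = rhsK certList k a b d := by
  have hL : ∀ e ∈ certList, e.1 < 16384 := by
    have := cert_keys
    rw [List.all_eq_true] at this
    intro e he
    simpa using this e he
  have h := hub_check a b d
  unfold certNum at h
  rw [list_sum_eq_sum_fiber certList hL (fun c => sym3 (rhs c) a b d), kronSym_eq,
    Finset.mul_sum] at h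
  have h' : ∑ k, (2 * sym3 (W5 k) a b d) * KB ^ idx4K k =
      ∑ k, rhsK certList k a b d * KB ^ idx4K k := by
    simp only [rhsK]
    rw [← h]
    exact Finset.sum_congr rfl fun k _ => by ring
  have hb : ∀ k, |rhsK certList k a b d| < 2 ^ 31 := by
    intro k
    have h1 := abs_filter_sum_le certList (fun e => decide (e.1 = idx4K k))
      (fun c => sym3 (rhs c) a b d)
    have h2 := cert_bound a b d
    unfold rhsK
    exact lt_of_le_of_lt h1 h2
  have key := digits_unique_idx (fun k => 2 * sym3 (W5 k) a b d) (fun k => rhsK certList k a b d)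
    (fun k => abs_two_sym3_W5_lt k a b d) hb h'
  exact congrFun key k

end Bridge


variable {V : Type*} {E : Type*} [Fintype E] [DecidableEq E] [DecidableEq V] {R : Type*}
  [Field R] [LinearOrder R] [IsStrictOrderedRing R]

omit [DecidableEq E] in
/-- The bundle weights of admissible edge weights are admissible. -/
lemma bundleProb_mem (ends : E → Sym2 V) (μ : Mark → V) {p : E → R} (hp : IsProbVec p)
    (i : Fin 7) : 0 ≤ bundleProb ends μ p i ∧ bundleProb ends μ p i ≤ 1 := by
  unfold bundleProb
  have h1 : 0 ≤ ∏ e ∈ bundleEdges ends μ i, (1 - p e) :=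
    Finset.prod_nonneg fun e _ => sub_nonneg.2 (hp.le_one e)
  have h2 : ∏ e ∈ bundleEdges ends μ i, (1 - p e) ≤ 1 :=
    Finset.prod_le_one (fun e _ => sub_nonneg.2 (hp.le_one e)) fun e _ => by
      linarith [hp.nonneg e]
  constructor <;> linarith

/-- **THE HUB THEOREM** — (HCOV) on the class R: for admissible weights, five distinct marks and
every root edge joining two marks, the covariance form is nonnegative. -/
theorem HCov_of_classR (p : E → R) (hp : IsProbVec p) (ends : E → Sym2 V) (o a₁ a₂ a₃ b : V)
    (hinj : Function.Injective (markOf o a₁ a₂ a₃ b)) (hR : ClassR ends (markOf o a₁ a₂ a₃ b)) :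
    CovForm.HCov p ends o a₁ a₂ a₃ b := by
  unfold CovForm.HCov
  rw [Gc_eq_GcB p ends o a₁ a₂ a₃ b hinj hR
    (fun π => prob p {ω | innerPat ends (markOf o a₁ a₂ a₃ b) ω = π}) fun π => rfl]
  refine GcB_nonneg (bundleProb_mem ends _ hp) fun k => ?_
  exact Ck_nonneg_of_check certList cert_nonneg k (coeff_identity k) _
    (fun π hπ => prob_innerPat_eq_zero p π hπ) (fun a => prob_nonneg hp _)
    (fun u v => Hslack_nonneg p hp u v)

end Summit.Ventures.PercRepro2.Hub
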